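/-
Copyright (c) 2026 the pub-hodgecm-mathlib formalisation cell (harness21).  Prover seat hodgecm-mathlib-LH5-p04 (g6), line LH5 (closer stub
`stub_S1finTFCovol`), (R3′) sub-bricks (s1) «`Z_f = range finAdelicBlockDiag`» + (s3) «blocks of `J₁ ⊕ᶠ J₂`» for the (R4) junction ★ p852390; 2026-09-02.
-/
import Literature.NumberTheory.Automorphic.UnitaryGroupBlockCentralizer          -- ★ `eq_finSum_of_commute`, `mem_range_blockDiagFin_iff_commute`, `finSum_commute_finSum_smul_one`
import Literature.NumberTheory.Automorphic.UnitaryGroupDirectSumCarriersFinite    -- ★ `finAdelicBlockDiag`, `finAdelic_finSum`, `rationalToFinAdelic`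
import Literature.NumberTheory.Automorphic.UnitaryGroupAdelicProduct              -- ★ `finPart`
import Literature.NumberTheory.Automorphic.AdelicUnitaryGroupDatum                -- ★ `cmDatum`, `rational_complexConj`
import Literature.NumberTheory.Automorphic.UnitaryGroupFrameEmbedding             -- ★ `hermForm_finSum_append`
import HarnessLib

/-!
# The FINITE-adelic centraliser of a rational block scalar is `U(J₁)(𝔸_f) × U(J₂)(𝔸_f)`, and the blocks of `J₁ ⊕ᶠ J₂` inherit hermitian-ness ∕ anisotropy
(Rogawski 1990 §3.8 Prop. 3.8.1 (a) p. 27 «`G_γ ≅ H′_ξ × E¹`», read at the finite adeles; Platonov–Rapinchuk 1994 §5.1)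

Topic `NumberTheory/Automorphic`; namespace `Literature.NumberTheory.Automorphic.UnitaryGroup`.  THEOREMS ONLY (no definition, no instance, no notation, no named
fact, no `sorry`).  The finite-adelic twin of ★ `UnitaryGroupBlockCentralizer` §3 (`centralizer_toAdelic_eq_range_adelicBlockDiag`, full adeles), over the same
algebra (★ `mem_range_blockDiagFin_iff_commute` — any commutative ring — at `S := 𝔸_E^∞`, ★ `finAdelic_finSum`) and the carriers ★ `finAdelicBlockDiag` ∕ `rationalToFinAdelic`.

* §1 (generic `F, E, c`, sizes `M₁ + M₂`, `J₁ J₂`; `a ≠ b ∈ E`; `δ ∈ U(J₁ ⊕ᶠ J₂)(F)` with matrix `a·1 ⊕ᶠ b·1`) `finAdelicBlockDiag_mul_rationalToFinAdelic_comm` (⇐),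
  `mem_range_finAdelicBlockDiag_of_commute` (⇒: `a − b ≠ 0` stays a unit of the `E`-algebra `𝔸_E^∞`), **`centralizer_rationalToFinAdelic_eq_range_finAdelicBlockDiag`**:
  `Z_{U(J₁ ⊕ᶠ J₂)(𝔸_{F,f})}(δ_f) = range finAdelicBlockDiag`.
* §2 (CM currency — the tokens of the LH5 letter Z1♭, whose finite Haar brick `tf` lives on `Z(finPart (toAdelic γ₀)) ≤ U(Ha ⊕ᶠ Hb)(𝔸_{L⁺,f})`) `finPart_cmDatum_toAdelic`
  (`(γ₀)_f = γ₀ ⊗ 1`, entrywise, as ★ `finPart_toAdelic`) and **`centralizer_finPart_cmDatum_toAdelic_eq_range_finAdelicBlockDiag`** — with ★ `finAdelicBlockDiag_mem_finAdelicIntegralLevel_iff`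
  the box of `Z_f` reads blockwise.
* §3 (any commutative ring `S`, involution `σ`) **`transpose_map_finSum_eq_iff`** (`J₁ ⊕ᶠ J₂` is `σ`-hermitian iff both blocks are), **`anisotropic_left_of_finSum`** ∕
  **`anisotropic_right_of_finSum`** (★ `hermForm_finSum_append` at `x ⊕ 0`, `0 ⊕ y`), and over a field **`isUnit_det_of_anisotropic`** (a kernel vector is isotropic) — the blockwise
  hypotheses `hHa hHb hda hdb` of ★ `UnitaryArchSingularCentralizerBlockModel` from Z1♭'s two binders on the sum.
HONEST LABEL: count-neutral plumbing for the (R3′) «block reading + product transport» file of the (R4) junction ★ p852390; no organ of the LH5 line is paid; Z1♭'s print floor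
[Kottwitz1988 Thm 1] untouched; HC_CM is proved only modulo the printed citations until rung 0 closes.

## References
* J. Rogawski, *Automorphic Representations of Unitary Groups in Three Variables*, Ann. of Math. Stud. 123 (1990), §3.8 Prop. 3.8.1 (a) p. 27. [Rogawski1990]
* V. Platonov, A. Rapinchuk, *Algebraic Groups and Number Theory*, Academic Press (1994), §5.1; §2.3 (hermitian forms, orthogonal sums). [PlatonovRapinchuk1994]
-/

set_option autoImplicit false

noncomputable section

open scoped MatrixGroups Matrix
open NumberField IsDedekindDomain

namespace Literature.NumberTheory.Automorphic.UnitaryGroup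

/-! ## §1 Generic: `Z_{U(J₁ ⊕ᶠ J₂)(𝔸_{F,f})}(δ_f) = range finAdelicBlockDiag` -/

section FinAdelic

variable (F E : Type) [Field F] [NumberField F] [Field E] [NumberField E] [Algebra F E]
  (c : E ≃ₐ[F] E) (M₁ M₂ : ℕ) (J₁ : Matrix (Fin M₁) (Fin M₁) E) (J₂ : Matrix (Fin M₂) (Fin M₂) E)

omit [NumberField F] in
/-- The matrix of `finAdelicBlockDiag (u₁, u₂)` is `u₁ ⊕ᶠ u₂`. [folklore] -/
private theorem coe_coe_finAdelicBlockDiag' (u : finAdelic F E c M₁ J₁ × finAdelic F E c M₂ J₂) :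
    (((finAdelicBlockDiag F E c M₁ M₂ J₁ J₂ u : finAdelic F E c (M₁ + M₂) (finSum M₁ M₂ J₁ J₂)) :
        GL (Fin (M₁ + M₂)) (FiniteAdeleRing (𝓞 E) E)) : Matrix (Fin (M₁ + M₂)) (Fin (M₁ + M₂)) (FiniteAdeleRing (𝓞 E) E)) =
      finSum M₁ M₂ ((u.1 : GL (Fin M₁) (FiniteAdeleRing (𝓞 E) E)) : Matrix (Fin M₁) (Fin M₁) (FiniteAdeleRing (𝓞 E) E))
        ((u.2 : GL (Fin M₂) (FiniteAdeleRing (𝓞 E) E)) : Matrix (Fin M₂) (Fin M₂) (FiniteAdeleRing (𝓞 E) E)) := by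
  rw [coe_finAdelicBlockDiag, coe_reindexGL, coe_blockDiagGL]
  rfl

omit [NumberField F] in
/-- The matrix of `δ_f` for `δ = a·1 ⊕ᶠ b·1` is `(a ⊗ 1)·1 ⊕ᶠ (b ⊗ 1)·1` over `𝔸_E^∞`. [folklore] -/
private theorem coe_rationalToFinAdelic_of_eq_finSum {a b : E} (δ : rational F E c (M₁ + M₂) (finSum M₁ M₂ J₁ J₂))
    (hδ : ((δ : GL (Fin (M₁ + M₂)) E) : Matrix _ _ E) = finSum M₁ M₂ (a • (1 : Matrix (Fin M₁) (Fin M₁) E)) (b • 1)) :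
    (((rationalToFinAdelic F E c (M₁ + M₂) (finSum M₁ M₂ J₁ J₂) δ : finAdelic F E c (M₁ + M₂) (finSum M₁ M₂ J₁ J₂)) :
        GL (Fin (M₁ + M₂)) (FiniteAdeleRing (𝓞 E) E)) : Matrix _ _ (FiniteAdeleRing (𝓞 E) E)) =
      finSum M₁ M₂ (algebraMap E (FiniteAdeleRing (𝓞 E) E) a • (1 : Matrix (Fin M₁) (Fin M₁) (FiniteAdeleRing (𝓞 E) E)))
        (algebraMap E (FiniteAdeleRing (𝓞 E) E) b • 1) := by
  rw [coe_rationalToFinAdelic]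
  show ((δ : GL (Fin (M₁ + M₂)) E) : Matrix (Fin (M₁ + M₂)) (Fin (M₁ + M₂)) E).map (algebraMap E (FiniteAdeleRing (𝓞 E) E)) = _
  rw [hδ, finSum_map]
  congr 1 <;>
    rw [Matrix.map_smul' _ _ _ (map_mul (algebraMap E (FiniteAdeleRing (𝓞 E) E))), Matrix.map_one _ (map_zero _) (map_one _)]

omit [NumberField F] in
/-- (⇐) **Block-diagonal finite-adelic points commute with `δ_f`** (`δ = a·1 ⊕ᶠ b·1` rational). [cite: Rogawski1990, §3.8 Prop. 3.8.1 p. 27] -/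
theorem finAdelicBlockDiag_mul_rationalToFinAdelic_comm {a b : E} (δ : rational F E c (M₁ + M₂) (finSum M₁ M₂ J₁ J₂))
    (hδ : ((δ : GL (Fin (M₁ + M₂)) E) : Matrix _ _ E) = finSum M₁ M₂ (a • (1 : Matrix (Fin M₁) (Fin M₁) E)) (b • 1))
    (u : finAdelic F E c M₁ J₁ × finAdelic F E c M₂ J₂) :
    finAdelicBlockDiag F E c M₁ M₂ J₁ J₂ u * rationalToFinAdelic F E c (M₁ + M₂) (finSum M₁ M₂ J₁ J₂) δ =
      rationalToFinAdelic F E c (M₁ + M₂) (finSum M₁ M₂ J₁ J₂) δ * finAdelicBlockDiag F E c M₁ M₂ J₁ J₂ u := by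
  apply Subtype.ext
  apply Units.ext
  rw [Subgroup.coe_mul, Subgroup.coe_mul, Units.val_mul, Units.val_mul, coe_rationalToFinAdelic_of_eq_finSum F E c M₁ M₂ J₁ J₂ δ hδ,
    coe_coe_finAdelicBlockDiag']
  exact finSum_commute_finSum_smul_one (algebraMap E (FiniteAdeleRing (𝓞 E) E) a) (algebraMap E (FiniteAdeleRing (𝓞 E) E) b)
    ((u.1 : GL (Fin M₁) (FiniteAdeleRing (𝓞 E) E)) : Matrix (Fin M₁) (Fin M₁) (FiniteAdeleRing (𝓞 E) E))
    ((u.2 : GL (Fin M₂) (FiniteAdeleRing (𝓞 E) E)) : Matrix (Fin M₂) (Fin M₂) (FiniteAdeleRing (𝓞 E) E))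

omit [NumberField F] in
/-- (⇒) **A finite-adelic point commuting with `δ_f` (`δ = a·1 ⊕ᶠ b·1` rational, `a ≠ b`) is block diagonal**: it lies in the image of ★ `finAdelicBlockDiag`
(★ `mem_range_blockDiagFin_iff_commute` over `𝔸_E^∞`, where `a − b ≠ 0`, a unit of the field `E`, stays a unit of the `E`-algebra `𝔸_E^∞`). [cite: Rogawski1990, §3.8 Prop. 3.8.1 p. 27] -/
theorem mem_range_finAdelicBlockDiag_of_commute {a b : E} (hab : a ≠ b)
    (δ : rational F E c (M₁ + M₂) (finSum M₁ M₂ J₁ J₂))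
    (hδ : ((δ : GL (Fin (M₁ + M₂)) E) : Matrix _ _ E) = finSum M₁ M₂ (a • (1 : Matrix (Fin M₁) (Fin M₁) E)) (b • 1))
    (z : finAdelic F E c (M₁ + M₂) (finSum M₁ M₂ J₁ J₂))
    (hz : z * rationalToFinAdelic F E c (M₁ + M₂) (finSum M₁ M₂ J₁ J₂) δ = rationalToFinAdelic F E c (M₁ + M₂) (finSum M₁ M₂ J₁ J₂) δ * z) :
    z ∈ (finAdelicBlockDiag F E c M₁ M₂ J₁ J₂).range := by
  have hunit : IsUnit (algebraMap E (FiniteAdeleRing (𝓞 E) E) a - algebraMap E (FiniteAdeleRing (𝓞 E) E) b) := by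
    rw [← map_sub]
    exact ((sub_ne_zero.2 hab).isUnit).map _
  -- `z` as an element of `U(c ⊗ 1, (J₁ ⊗ 1) ⊕ᶠ (J₂ ⊗ 1))` over `𝔸_E^∞`
  set z' : unitaryGroupOfForm (conjFiniteAdele F E c) (finSum M₁ M₂ (finiteAdelicForm E M₁ J₁) (finiteAdelicForm E M₂ J₂)) :=
    MulEquiv.subgroupCongr (finAdelic_finSum F E c M₁ M₂ J₁ J₂) z with hz'def
  have hz'z : (z' : GL (Fin (M₁ + M₂)) (FiniteAdeleRing (𝓞 E) E)) = (z : GL (Fin (M₁ + M₂)) (FiniteAdeleRing (𝓞 E) E)) :=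
    MulEquiv.subgroupCongr_apply _ _
  have key := mem_range_blockDiagFin_iff_commute (conjFiniteAdele F E c) (finiteAdelicForm E M₁ J₁) (finiteAdelicForm E M₂ J₂) hunit z'
  rw [hz'z] at key
  have hcomm : ((z : GL (Fin (M₁ + M₂)) (FiniteAdeleRing (𝓞 E) E)) : Matrix (Fin (M₁ + M₂)) (Fin (M₁ + M₂)) (FiniteAdeleRing (𝓞 E) E)) *
      finSum M₁ M₂ (algebraMap E (FiniteAdeleRing (𝓞 E) E) a • (1 : Matrix (Fin M₁) (Fin M₁) _)) (algebraMap E (FiniteAdeleRing (𝓞 E) E) b • 1) =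
      finSum M₁ M₂ (algebraMap E (FiniteAdeleRing (𝓞 E) E) a • (1 : Matrix (Fin M₁) (Fin M₁) _)) (algebraMap E (FiniteAdeleRing (𝓞 E) E) b • 1) *
        ((z : GL (Fin (M₁ + M₂)) (FiniteAdeleRing (𝓞 E) E)) : Matrix (Fin (M₁ + M₂)) (Fin (M₁ + M₂)) (FiniteAdeleRing (𝓞 E) E)) := by
    rw [← coe_rationalToFinAdelic_of_eq_finSum F E c M₁ M₂ J₁ J₂ δ hδ]
    have h := congrArg (fun w : finAdelic F E c (M₁ + M₂) (finSum M₁ M₂ J₁ J₂) =>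
      ((w : GL (Fin (M₁ + M₂)) (FiniteAdeleRing (𝓞 E) E)) : Matrix (Fin (M₁ + M₂)) (Fin (M₁ + M₂)) (FiniteAdeleRing (𝓞 E) E))) hz
    simp only [Subgroup.coe_mul, Units.val_mul] at h
    exact h
  obtain ⟨u, hu⟩ := key.2 hcomm
  refine ⟨u, Subtype.ext ?_⟩
  rw [coe_finAdelicBlockDiag, ← coe_blockDiagFin_eq, hu, hz'z]

omit [NumberField F] in
/-- **The finite-adelic centraliser of a rational block scalar is `U(J₁)(𝔸_{F,f}) × U(J₂)(𝔸_{F,f})`**: for `a ≠ b` in `E` and a rational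
`δ ∈ U(J₁ ⊕ᶠ J₂)(F)` with matrix `a·1 ⊕ᶠ b·1`, the centraliser of `δ_f` in `U(J₁ ⊕ᶠ J₂)(𝔸_{F,f})` is the image of ★ `finAdelicBlockDiag` — the finite-adelic twin of ★
`centralizer_toAdelic_eq_range_adelicBlockDiag`. [cite: Rogawski1990, §3.8 Prop. 3.8.1 p. 27] [cite: PlatonovRapinchuk1994, §5.1] -/
theorem centralizer_rationalToFinAdelic_eq_range_finAdelicBlockDiag {a b : E} (hab : a ≠ b)
    (δ : rational F E c (M₁ + M₂) (finSum M₁ M₂ J₁ J₂))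
    (hδ : ((δ : GL (Fin (M₁ + M₂)) E) : Matrix _ _ E) = finSum M₁ M₂ (a • (1 : Matrix (Fin M₁) (Fin M₁) E)) (b • 1)) :
    Subgroup.centralizer ({rationalToFinAdelic F E c (M₁ + M₂) (finSum M₁ M₂ J₁ J₂) δ} : Set (finAdelic F E c (M₁ + M₂) (finSum M₁ M₂ J₁ J₂))) =
      (finAdelicBlockDiag F E c M₁ M₂ J₁ J₂).range := by
  ext z
  rw [Subgroup.mem_centralizer_singleton_iff]
  constructor
  · exact mem_range_finAdelicBlockDiag_of_commute F E c M₁ M₂ J₁ J₂ hab δ hδ z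
  · rintro ⟨u, rfl⟩
    exact finAdelicBlockDiag_mul_rationalToFinAdelic_comm F E c M₁ M₂ J₁ J₂ δ hδ u

end FinAdelic

/-! ## §2 CM currency: `Z(finPart (toAdelic γ₀))` for the block model of the LH5 letter Z1♭ -/

section CM

variable (L : Type) [Field L] [NumberField L] [IsCMField L]

/-- **`(γ₀)_f = γ₀ ⊗ 1` in the `cmDatum` currency**: the finite component of `toAdelic γ₀` is the finite-adelic diagonal image of `γ₀` (entrywise,
definitional; the generic-datum twin is ★ `finPart_toAdelic`). [cite: PlatonovRapinchuk1994, §5.1] -/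
theorem finPart_cmDatum_toAdelic (N : ℕ) (H : Matrix (Fin N) (Fin N) L) (γ₀ : (cmDatum L N H).Rational) :
    finPart (↥(maximalRealSubfield L)) L (IsCMField.complexConj L) N H ((cmDatum L N H).toAdelic γ₀) =
      rationalToFinAdelic (↥(maximalRealSubfield L)) L (IsCMField.complexConj L) N H
        ⟨(γ₀.val : GL (Fin N) L), by rw [rational_complexConj]; exact γ₀.2⟩ :=
  Subtype.ext (Matrix.GeneralLinearGroup.ext fun _ _ => rfl)

/-- **THE FINITE BRICK'S CARRIER IN THE BLOCK MODEL**: for `Ha ∈ M₂(L)`, `Hb ∈ M₁(L)`, `a ≠ b` and `γ₀ ∈ U(Ha ⊕ᶠ Hb)(L⁺)` with matrix `a·1₂ ⊕ᶠ b·1₁`,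
the centraliser of `(γ₀)_f` in `U(Ha ⊕ᶠ Hb)(𝔸_{L⁺,f})` — the group on which Z1♭'s finite Haar brick `tf` lives — IS the image of
`finAdelicBlockDiag : U(Ha)(𝔸_f) × U(Hb)(𝔸_f) →* U(Ha ⊕ᶠ Hb)(𝔸_f)`; with ★ `finAdelicBlockDiag_mem_finAdelicIntegralLevel_iff` its box `Z_f ∩ K_f⁰` reads blockwise.
[cite: Rogawski1990, §3.8 Prop. 3.8.1 p. 27; §14.5 Lemma 14.5.2 (b) p. 238] [cite: PlatonovRapinchuk1994, §5.1] -/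
theorem centralizer_finPart_cmDatum_toAdelic_eq_range_finAdelicBlockDiag (Ha : Matrix (Fin 2) (Fin 2) L) (Hb : Matrix (Fin 1) (Fin 1) L)
    {a b : L} (hab : a ≠ b) (γ₀ : (cmDatum L 3 (finSum 2 1 Ha Hb)).Rational)
    (hγ₀ : ((γ₀.val : GL (Fin 3) L) : Matrix (Fin 3) (Fin 3) L) = finSum 2 1 (a • (1 : Matrix (Fin 2) (Fin 2) L)) (b • 1)) :
    Subgroup.centralizer ({finPart (↥(maximalRealSubfield L)) L (IsCMField.complexConj L) 3 (finSum 2 1 Ha Hb)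
        ((cmDatum L 3 (finSum 2 1 Ha Hb)).toAdelic γ₀)} :
          Set (finAdelic (↥(maximalRealSubfield L)) L (IsCMField.complexConj L) 3 (finSum 2 1 Ha Hb))) =
      (finAdelicBlockDiag (↥(maximalRealSubfield L)) L (IsCMField.complexConj L) 2 1 Ha Hb).range := by
  rw [finPart_cmDatum_toAdelic]
  exact centralizer_rationalToFinAdelic_eq_range_finAdelicBlockDiag (↥(maximalRealSubfield L)) L (IsCMField.complexConj L) 2 1 Ha Hb hab _ hγ₀

end CM

/-! ## §3 The blocks of `J₁ ⊕ᶠ J₂`: hermitian-ness, anisotropy, non-degeneracy -/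

section Blocks

open Literature.AlgebraicGeometry.ShimuraVarieties (hermForm)

variable {S : Type*} [CommRing S] (σ : S →+* S) {N₁ N₂ : ℕ}

/-- `ᵗ(σ(J₁ ⊕ᶠ J₂)) = ᵗ(σJ₁) ⊕ᶠ ᵗ(σJ₂)`. [folklore] -/
private theorem transpose_map_finSum (J₁ : Matrix (Fin N₁) (Fin N₁) S) (J₂ : Matrix (Fin N₂) (Fin N₂) S) :
    ((finSum N₁ N₂ J₁ J₂).map σ)ᵀ = finSum N₁ N₂ ((J₁.map σ)ᵀ) ((J₂.map σ)ᵀ) := by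
  rw [finSum_map]
  simp only [finSum, Matrix.reindex_apply, Matrix.transpose_submatrix, Matrix.fromBlocks_transpose, Matrix.transpose_zero]

/-- `⊕ᶠ` is injective in the pair of blocks. [folklore] -/
private theorem finSum_inj' {A C : Matrix (Fin N₁) (Fin N₁) S} {B D : Matrix (Fin N₂) (Fin N₂) S} (h : finSum N₁ N₂ A B = finSum N₁ N₂ C D) :
    A = C ∧ B = D := by
  have h' := (Matrix.reindex finSumFinEquiv finSumFinEquiv).injective h
  rw [Matrix.fromBlocks_inj] at h'
  exact ⟨h'.1, h'.2.2.2⟩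

/-- **`J₁ ⊕ᶠ J₂` is `σ`-hermitian iff both blocks are.** [cite: PlatonovRapinchuk1994, §2.3] -/
theorem transpose_map_finSum_eq_iff (J₁ : Matrix (Fin N₁) (Fin N₁) S) (J₂ : Matrix (Fin N₂) (Fin N₂) S) :
    ((finSum N₁ N₂ J₁ J₂).map σ)ᵀ = finSum N₁ N₂ J₁ J₂ ↔ (J₁.map σ)ᵀ = J₁ ∧ (J₂.map σ)ᵀ = J₂ := by
  rw [transpose_map_finSum]
  exact ⟨fun h => finSum_inj' h, fun h => by rw [h.1, h.2]⟩

/-- `⟨x ⊕ 0, x ⊕ 0⟩_{J₁ ⊕ᶠ J₂} = ⟨x, x⟩_{J₁}`. [folklore] -/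
private theorem hermForm_finSum_append_zero (J₁ : Matrix (Fin N₁) (Fin N₁) S) (J₂ : Matrix (Fin N₂) (Fin N₂) S) (x : Fin N₁ → S) :
    hermForm σ (finSum N₁ N₂ J₁ J₂) (Fin.append x 0) (Fin.append x 0) = hermForm σ J₁ x x := by
  rw [hermForm_finSum_append, show hermForm σ J₂ 0 0 = 0 by rw [hermForm, Matrix.mulVec_zero, dotProduct_zero], add_zero]

/-- `⟨0 ⊕ y, 0 ⊕ y⟩_{J₁ ⊕ᶠ J₂} = ⟨y, y⟩_{J₂}`. [folklore] -/
private theorem hermForm_finSum_zero_append (J₁ : Matrix (Fin N₁) (Fin N₁) S) (J₂ : Matrix (Fin N₂) (Fin N₂) S) (y : Fin N₂ → S) :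
    hermForm σ (finSum N₁ N₂ J₁ J₂) (Fin.append 0 y) (Fin.append 0 y) = hermForm σ J₂ y y := by
  rw [hermForm_finSum_append, show hermForm σ J₁ 0 0 = 0 by rw [hermForm, Matrix.mulVec_zero, dotProduct_zero], zero_add]

/-- **Anisotropy descends to the first block of an orthogonal sum.** [cite: PlatonovRapinchuk1994, §2.3] -/
theorem anisotropic_left_of_finSum (J₁ : Matrix (Fin N₁) (Fin N₁) S) (J₂ : Matrix (Fin N₂) (Fin N₂) S)
    (h : ∀ z : Fin (N₁ + N₂) → S, hermForm σ (finSum N₁ N₂ J₁ J₂) z z = 0 → z = 0) :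
    ∀ x : Fin N₁ → S, hermForm σ J₁ x x = 0 → x = 0 := by
  intro x hx
  have hz := h (Fin.append x 0) (by rw [hermForm_finSum_append_zero]; exact hx)
  funext i
  have hi := congrFun hz (Fin.castAdd N₂ i)
  rw [Fin.append_left] at hi
  exact hi

/-- **Anisotropy descends to the second block of an orthogonal sum.** [cite: PlatonovRapinchuk1994, §2.3] -/
theorem anisotropic_right_of_finSum (J₁ : Matrix (Fin N₁) (Fin N₁) S) (J₂ : Matrix (Fin N₂) (Fin N₂) S)
    (h : ∀ z : Fin (N₁ + N₂) → S, hermForm σ (finSum N₁ N₂ J₁ J₂) z z = 0 → z = 0) :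
    ∀ y : Fin N₂ → S, hermForm σ J₂ y y = 0 → y = 0 := by
  intro y hy
  have hz := h (Fin.append 0 y) (by rw [hermForm_finSum_zero_append]; exact hy)
  funext j
  have hj := congrFun hz (Fin.natAdd N₁ j)
  rw [Fin.append_right] at hj
  exact hj

/-- **An anisotropic form over a field is non-degenerate**: a kernel vector of `J` is isotropic, so `det J` is a unit (the `IsUnit` dress of ★
`det_ne_zero_of_anisotropic`, for any size). [cite: PlatonovRapinchuk1994, §2.3] -/
theorem isUnit_det_of_anisotropic {K : Type*} [Field K] (τ : K →+* K) {n : Type*} [Fintype n] [DecidableEq n] (J : Matrix n n K)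
    (h : ∀ x : n → K, hermForm τ J x x = 0 → x = 0) : IsUnit J.det := by
  rw [isUnit_iff_ne_zero]
  intro hdet
  obtain ⟨x, hx, hJx⟩ := Matrix.exists_mulVec_eq_zero_iff.mpr hdet
  refine hx (h x ?_)
  rw [hermForm, hJx, dotProduct_zero]

end Blocks

end Literature.NumberTheory.Automorphic.UnitaryGroup

end
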